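import Summits.QuantumFields.YangMills.Theorems.BalabanUVNodesN15TwoSpacingGluingCurvedKnitSmallFieldPair
import Summits.QuantumFields.YangMills.Theorems.BalabanUVNodesN15TwoSpacingGluingCurvedCoverDefect
import Summits.QuantumFields.YangMills.Theorems.BalabanUVNodesN15TwoSpacingGluingNeumannRemainder
import Summits.QuantumFields.YangMills.Theorems.BalabanUVNodesN15TwoSpacingGluingAveragingDefect
import HarnessLib

/-!
# THE GLUING STEP AT TWO LATTICE SPACINGS — (Λ2e) ENTRY 3 OF (3.42) FOR THE LIVE-BACKGROUND GLUED PAIR, CONSTRUCTED: the two-spacing η-defect of `(Δ′_{U′}G′, Δ_UG)` through the inverse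
# identity `Δ_UG = 1 − N_LG`, with rate and no displayed row (dag-n15-c g16, FILE 134; N15 = NE2, s1 «background-layer OPERATOR ingredient»)

Cell `pub-ymgap`, seat `pub-ymgap-dag-n15-c` (R134 (a); HUMAN RULING D-0062), generation 16.  `bears_on: R4∕N15 · K3⁸ SpineGivenEndpointR13SepCoPHV (stmt-QuantumFields-27366)`.
Filed `--kind proof --supports stmt-QuantumFields-27366 --as helper` — COUNT-NEUTRAL.  Theorems only; 0 `def`, 0 `sorry`.  Imports BY NAME FILE 133 `…SmallFieldPair` (`sf_cvGlued_pair_spec`; through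
it FILE 130 `sf_idef_cvGlued`), FILE 121 `…CurvedCoverDefect` (`hasMaj_idef_tensorId`, `hasMaj_src_tgt_congr`, `hasMaj_tgt_congr`, `liftBlk_blkCover_comp_kingPrV`), dag-n15-a∕dag-n15-c
`…NeumannRemainder` (`hasMaj_nonlocalPart`), `…AveragingDefect` (`hasMaj_idef_nonlocal_family`), n15-a `hasMaj_landauRe`, M4 `hasMaj_tensorId`, r1 `idef_sub`∕`idef_comp`∕`hasMaj_comp_exp`∕
`rowSum_unitTorusGeo`.  Nothing in the tree is modified.

WHY.  Of the four (3.42) entries (`G`, `∇_UG`, `G∇*_U`, `Δ_UG`) the LAPLACIAN entry needs NO gradient estimate: the glued operator is a two-sided inverse, `(Δ_U + N_L)G = 1` (FILE 133), so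
`Δ_UG = 1 − N_LG` and `𝔇(Δ′G′, ΔG) = 𝔇(1,1) − 𝔇(N′_LG′, N_LG) = −(N′_L ∘ 𝔇(G′,G) + 𝔇(N′_L,N_L) ∘ G)` (r1 `idef_sub`, `idef_comp`; `𝔇(1,1) = 0` for equal transports).  Every factor
has a landed majorant: `N′_L` (dag-n15-a `hasMaj_nonlocalPart` + `hasMaj_landauRe`, lifted by `hasMaj_tensorId`), `𝔇(G′,G)` (FILE 130, rate `(L^k)^{−1∕16} + c·η`), `𝔇(N′_L,N_L)`
(`hasMaj_idef_nonlocal_family` at `γ = 1∕8`: rate `(L^k)^{−1∕16}`), `G` (FILE 133), composed by `hasMaj_comp_exp` at half the smallest rate.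

WHAT.  `idef_id_id` (the defect of the identities along equal transports vanishes); ★★★ `sf_idef_lap_cvGlued` — for odd `L ≥ 7`, `a > 0`, `ι`: `∃ ρ w₀ R₀ D₃, 0 < ρ ∧ 0 < R₀ ∧ 0 ≤ D₃ ∧
∀ mv kk r (k ≥ 1, L^m ≥ w₀) e he, ∀ A′` skew-Hermitian in the C² window (FILE 130's hypotheses):
`HasMaj (CvNorm) (ofBlocks … (liftBlk (cvBlk∘π̂) ι)) (𝔇_π̂ (Δ′ ∘ G′) (Δ ∘ G)) (D₃·((L^k)^{−1∕16} + scale·(1+|J⊕J|)·η)·e^{−ρd})` — ENTRY 3 of the live family with NO displayed row.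

HONEST FRAMING ∕ LIMITS.  Assembly of LANDED theorems; MODEL operator (covariant Laplacian (3.50) ⊗ colour + FLAT nonlocal part (1.69) — NOT Bałaban's `Δ_a(U)` (3.26)); MODEL class ∕ pairing
∕ carriers; constants crude; the (3.42) entry SHAPE, not a printed estimate; nothing of [B5]∕[B6]∕[B9] asserted.  NE2⁺ NOT PRINTED, NOT proved; N15 NOT discharged; K3⁸ OPEN, skeleton v6
untouched (0∕2); counts of record UNMOVED (typed 28∕28 · discharged 5∕27 · A 5∕28); one finite 𝕋⁴ at fixed ε — NOT infinite volume, NOT OS on ℝ⁴, NOT a mass gap, NOT Clay; R4 closes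
the conditional finite-𝕋⁴ rung `BalabanLadder.UV` only.  Restate-immune (no Theses import).
-/

noncomputable section

open scoped BigOperators Matrix Matrix.Norms.Frobenius

namespace Summit.QuantumFields.YangMills.BalabanUVNodes.N15.Gluing

open Literature.MathematicalPhysics.QuantumFieldTheory.Balaban1983to89
open Literature.MathematicalPhysics.QuantumFieldTheory.Balaban1983to89.B11SectG (BlockNorm HasMaj hasMaj_comp_exp)
open Literature.MathematicalPhysics.QuantumFieldTheory.Balaban1983to89.T4EtaRateDefect (idef idef_comp idef_sub)
open Literature.MathematicalPhysics.QuantumFieldTheory.Balaban1983to89.T4EtaRateCoeffDefect (pull)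
open Literature.MathematicalPhysics.QuantumFieldTheory.Balaban1983to89.B6Prop26Gluing (mulOp)
open Literature.MathematicalPhysics.QuantumFieldTheory.Balaban1983to89.B6UnitTorusCarrier (unitTorusGeo unitTorusGeo_dist_nonneg triangle254_unitTorusGeo rowSum_unitTorusGeo)
open Literature.MathematicalPhysics.QuantumFieldTheory.King1986.Torus (blockOf tdistT tdistT_nonneg)
open Literature.Barriers.QuantumFields (traceForm)
open Summit.QuantumFields.YangMills.BalabanUVNodes.N15.BackgroundLayer (covLapM gavgM)
open Summit.QuantumFields.YangMills.BalabanUVNodes.N15.VectorPiece (bshiftEquiv kingPrV tensorId hasMaj_tensorId blkFine)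
open Summit.QuantumFields.YangMills.BalabanUVNodes.N15.MatrixSpecies (coordMat basisConst basisConst_nonneg liftBlk liftMap)
open Summit.QuantumFields.YangMills.BalabanUVNodes.N15.TwoGrid (landauRe qvRe qvAdjRe hasMaj_landauRe paramsOf)
open Summit.QuantumFields.YangMills.BalabanUVNodes.N15.CurvedSpecies (gaugePair)

variable {d : ℕ} {L : ℕ} [NeZero L]

/-- The defect of the identities along equal transports vanishes: `𝔇_{τ,τ}(1, 1) = τ − τ = 0`. [folklore] -/
theorem idef_id_id {F F' : Type} [AddCommGroup F] [Module ℝ F] [AddCommGroup F'] [Module ℝ F'] (τ : F →ₗ[ℝ] F') :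
    idef τ τ (LinearMap.id : F' →ₗ[ℝ] F') (LinearMap.id : F →ₗ[ℝ] F) = 0 := by
  rw [idef, LinearMap.id_comp, LinearMap.comp_id, sub_self]

set_option maxHeartbeats 800000 in
/-- ★★★ **ENTRY 3 OF (3.42) FOR THE LIVE-BACKGROUND GLUED PAIR, CONSTRUCTED, WITH RATE**: for odd `L ≥ 7`, `a > 0`, `ι` there are `ρ, R₀ > 0`, `w₀`, `D₃ ≥ 0` such that on every doubled torus
`2L·L^m` of the cover (`k ≥ 1`, `L^m ≥ w₀`) and every refinement `r`, for trace-form coordinates `e` and every skew-Hermitian fine potential `A′` in the C² window at scale `r_A` (FILE 130's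
hypotheses), the η-defect along King's bond pairing of the LAPLACIAN ENTRIES `(Δ′_{Ad e^{η′A′}}G′, Δ_{Ad e^{ηĀ′}}G)` of the live glued pair is `≤ D₃·((L^k)^{−1∕16} + scale·(1+|J⊕J|)·η)·e^{−ρ|y−y′|}`
blockwise — through `Δ_UG = 1 − N_LG`: `𝔇 = −(N′_L𝔇(G′,G) + 𝔇(N′_L,N_L)G)`.  MODEL operator ∕ class ∕ pairing ∕ carriers; NOT a printed estimate.
[cite: Balaban1985BackgroundPropagators, (3.42) p.397 (fourth entry: shape), Thm 3.14 pp.426–427 (difference template); Balaban1984PropagatorsI, (1.69) p.29, (1.126) p.38; Balaban1984PropagatorsII, (2.91)–(2.93) p.239; King1986, p.664 (pairing)] -/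
theorem sf_idef_lap_cvGlued (hL : Odd L ∧ 1 < L) (hL7 : 7 ≤ L) {a : ℝ} (ha : 0 < a) (ι : Type) [Fintype ι] [DecidableEq ι] :
    ∃ ρ w₀ R₀ D₃ : ℝ, 0 < ρ ∧ 0 < R₀ ∧ 0 ≤ D₃ ∧
      ∀ (mv kk r : ℕ), 1 ≤ kk → w₀ ≤ ((L ^ mv : ℕ) : ℝ) →
      ∀ {mm : Type} [Fintype mm] [DecidableEq mm] (e : Matrix mm mm ℂ ≃L[ℝ] (ι → ℝ)), (∀ A B : Matrix mm mm ℂ, traceForm A B = e A ⬝ᵥ e B) →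
      ∀ (A' : Fin (d + 1) → CvX' d L mv kk r hL → Matrix mm mm ℂ), (∀ μ x', (A' μ x')ᴴ = -A' μ x') →
      ∀ (rA : ℝ), 0 ≤ rA → (∀ μ x', ‖A' μ x'‖ ≤ rA) →
        (∀ μ κ x', ‖A' μ (bshiftEquiv (cvM d L mv kk hL) (L ^ r * L ^ kk) κ x') - A' μ x'‖ ≤ rA * ((((L ^ r * L ^ kk : ℕ) : ℝ))⁻¹)) →
        (∀ μ κ x', ‖(A' μ (bshiftEquiv (cvM d L mv kk hL) (L ^ r * L ^ kk) κ x') - A' μ x') -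
            (A' μ (bshiftEquiv (cvM d L mv kk hL) (L ^ r * L ^ kk) κ ((bshiftEquiv (cvM d L mv kk hL) (L ^ r * L ^ kk) μ).symm x')) -
              A' μ ((bshiftEquiv (cvM d L mv kk hL) (L ^ r * L ^ kk) μ).symm x'))‖ ≤ rA * ((((L ^ r * L ^ kk : ℕ) : ℝ))⁻¹) * ((((L ^ r * L ^ kk : ℕ) : ℝ))⁻¹)) →
        2 * ((1 + Fintype.card (Fin (d + 1))) * ((3 + 2 * ((d : ℝ) + 1)) * rA)) ≤ 1 →
        (14 * Real.exp 1 * (1 + Fintype.card (Fin (d + 1))) * basisConst e * ((1 + Fintype.card (Fin (d + 1))) * ((3 + 2 * ((d : ℝ) + 1)) * rA))) * (1 + Fintype.card (Fin (d + 1) ⊕ Fin (d + 1))) ≤ R₀ →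
        HasMaj (CvNorm d L mv kk hL ι) (BlockNorm.ofBlocks (unitTorusGeo L kk (cvM d L mv kk hL)) (liftBlk (cvBlk d L mv kk hL ∘ kingPrV L kk r (cvM d L mv kk hL)) ι))
          (idef (pull (liftMap (kingPrV L kk r (cvM d L mv kk hL)) ι)) (pull (liftMap (kingPrV L kk r (cvM d L mv kk hL)) ι)) ((covLapM (bshiftEquiv (cvM d L mv kk hL) (L ^ r * L ^ kk)) ((((L ^ r * L ^ kk : ℕ) : ℝ))⁻¹) (gaugePair (bshiftEquiv (cvM d L mv kk hL) (L ^ r * L ^ kk)) (fun μ x' => coordMat e (ContinuousLinearMap.mulLeftRight ℝ (Matrix mm mm ℂ) (NormedSpace.exp (((((L ^ r * L ^ kk : ℕ) : ℝ))⁻¹) • A' μ x')) (NormedSpace.exp (((((L ^ r * L ^ kk : ℕ) : ℝ))⁻¹) • A' μ x'))ᴴ)))) ∘ₗ (cvGlued' d L mv kk r hL a ((((L ^ r * L ^ kk : ℕ) : ℝ))⁻¹) ι e (fun _ _ => (1 : Matrix mm mm ℂ)) (fun μ x' => NormedSpace.exp (((((L ^ r * L ^ kk : ℕ) : ℝ))⁻¹)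 • A' μ x')) (cvNL' d L mv kk r hL a ι) (fun _ => 0))) ((covLapM (bshiftEquiv (cvM d L mv kk hL) (L ^ kk)) ((((L ^ kk : ℕ) : ℝ))⁻¹) (gaugePair (bshiftEquiv (cvM d L mv kk hL) (L ^ kk)) (fun μ x => coordMat e (ContinuousLinearMap.mulLeftRight ℝ (Matrix mm mm ℂ) (NormedSpace.exp (((((L ^ kk : ℕ) : ℝ))⁻¹) • gavgM (Matrix mm mm ℂ) (Fin (d + 1)) (kingPrV L kk r (cvM d L mv kk hL)) A' μ x)) (NormedSpace.exp (((((L ^ kk : ℕ) : ℝ))⁻¹) • gavgM (Matrix mm mm ℂ) (Fin (d + 1)) (kingPrV L kk r (cvM d L mv kk hL)) A' μ x))ᴴ)))) ∘ₗ (cvGlued d L mv kk hL a ((((L ^ kk : ℕ) : ℝ))⁻¹) ι e (fun _ _ => (1 : Matrix mm mm ℂ)) (fun μ x => NormedSpace.exp (((((L ^ kk : ℕ) : ℝ))⁻¹) • gavgM (Matrix mm mm ℂ) (Fin (d + 1)) (kingPrV L kk r (cvM d L mv kk hL)) A' μ x)) (cvNL d L mv kk hL a ι) (fun _ => 0)))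)
          (fun y y' => D₃ * ((((L ^ kk : ℕ) : ℝ)) ^ (-(1 / 16 : ℝ)) + (14 * Real.exp 1 * (1 + Fintype.card (Fin (d + 1))) * basisConst e * ((1 + Fintype.card (Fin (d + 1))) * ((3 + 2 * ((d : ℝ) + 1)) * rA))) * (1 + Fintype.card (Fin (d + 1) ⊕ Fin (d + 1))) * ((((L ^ kk : ℕ) : ℝ))⁻¹)) * Real.exp (-(ρ * (unitTorusGeo L kk (cvM d L mv kk hL)).dist y y'))) := by
  have hLpos : 0 < L := Nat.pos_of_ne_zero (NeZero.ne L)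
  have hLodd : Odd L := hL.1
  have hL2 : 2 ≤ L := by omega
  obtain ⟨δa, wa, Ra, Da, hδa, hRa, Ha⟩ := sf_idef_cvGlued (d := d) hL hL7 ha ι
  obtain ⟨δb, wb, Rb, Bb, hδb, hRb, hBb, Hb⟩ := sf_cvGlued_pair_spec (d := d) hL hL7 ha ι
  obtain ⟨δ₁, C₁, hδ₁, hC₁, HL⟩ := hasMaj_landauRe (d := d) (L := L)
  obtain ⟨δv, rr, hδv, hrr, HV⟩ := hasMaj_idef_nonlocal_family (d := d) hLodd hL2 ha (γ := 1 / 8) (by norm_num) (by norm_num)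
  -- the master rate
  let m : ℝ := min (min (δa / 16) δb) (min δ₁ δv)
  have hm0 : 0 < m := lt_min (lt_min (by positivity) hδb) (lt_min hδ₁ hδv)
  have hma : m ≤ δa / 16 := (min_le_left _ _).trans (min_le_left _ _)
  have hmb : m ≤ δb := (min_le_left _ _).trans (min_le_right _ _)
  have hm₁ : m ≤ δ₁ := (min_le_right _ _).trans (min_le_left _ _)
  have hmv : m ≤ δv := (min_le_right _ _).trans (min_le_right _ _)
  let cr : ℝ := B4Sect5Proof.latticeConst (d + 1) (m / 2)
  have hcr0 : 0 ≤ cr := B4Sect5Proof.latticeConst_nonneg (d + 1) (by positivity)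
  let cN : ℝ := |a| * (Real.exp m * Real.exp m) + C₁
  have hcN0 : 0 ≤ cN := by positivity
  refine ⟨m / 2, max wa wb, min Ra Rb, cr * (cN * max Da 0 + rr * Bb), by positivity, lt_min hRa hRb, by positivity, fun mv kk r hk hw₀ => ?_⟩
  intro mm _ _ e he A' hA' rA hrA h1 h2 h3 hr2 hRle
  have hwa : wa ≤ ((L ^ mv : ℕ) : ℝ) := (le_max_left _ _).trans hw₀
  have hwb : wb ≤ ((L ^ mv : ℕ) : ℝ) := (le_max_right _ _).trans hw₀
  have key0 := Ha mv kk r hk hwa e he A' hA' rA hrA h1 h2 h3 hr2 (hRle.trans (min_le_left _ _))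
  obtain ⟨⟨hG, -, hGi⟩, ⟨-, -, hGi'⟩⟩ := Hb mv kk r hk hwb e he A' hA' rA hrA h1 h2 h3 hr2 (hRle.trans (min_le_right _ _))
  -- `Δ G = 1 − N G` on both grids
  rw [LinearMap.add_comp] at hGi hGi'
  rw [eq_sub_of_add_eq hGi, eq_sub_of_add_eq hGi', idef_sub, idef_id_id, zero_sub, idef_comp (pull (liftMap (kingPrV L kk r (cvM d L mv kk hL)) ι)) (pull (liftMap (kingPrV L kk r (cvM d L mv kk hL)) ι)) (pull (liftMap (kingPrV L kk r (cvM d L mv kk hL)) ι))]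
  -- positivity of the scalars
  have hkpos : (0 : ℝ) < ((L ^ kk : ℕ) : ℝ) := Nat.cast_pos.mpr (pow_pos hLpos kk)
  have hx0 : (0 : ℝ) ≤ (((L ^ kk : ℕ) : ℝ)) ^ (-(1 / 16 : ℝ)) := Real.rpow_nonneg hkpos.le _
  have hκ0 : 0 ≤ basisConst e := basisConst_nonneg e
  have hP0 : 0 ≤ (((L ^ kk : ℕ) : ℝ)) ^ (-(1 / 16 : ℝ)) + (14 * Real.exp 1 * (1 + Fintype.card (Fin (d + 1))) * basisConst e * ((1 + Fintype.card (Fin (d + 1))) * ((3 + 2 * ((d : ℝ) + 1)) * rA))) * (1 + Fintype.card (Fin (d + 1) ⊕ Fin (d + 1))) * ((((L ^ kk : ℕ) : ℝ))⁻¹) := by positivity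
  -- (a) the fine nonlocal part on the coloured carrier, read on the cover's blocks
  have hNL' := hasMaj_nonlocalPart (L := L) (kk := kk) (M := cvM d L mv kk hL) (n := L ^ r * L ^ kk) (a := a) hC₁.le hm0.le hm₁ (HL kk (L ^ r * L ^ kk) (cvM d L mv kk hL))
  have hN'ι : HasMaj (BlockNorm.ofBlocks (unitTorusGeo L kk (cvM d L mv kk hL)) (liftBlk (cvBlk d L mv kk hL ∘ kingPrV L kk r (cvM d L mv kk hL)) ι)) (BlockNorm.ofBlocks (unitTorusGeo L kk (cvM d L mv kk hL)) (liftBlk (cvBlk d L mv kk hL ∘ kingPrV L kk r (cvM d L mv kk hL)) ι)) (cvNL' d L mv kk r hL a ι) (fun y y' => cN * Real.exp (-(m * (unitTorusGeo L kk (cvM d L mv kk hL)).dist y y'))) :=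
    hasMaj_src_tgt_congr (liftBlk_blkCover_comp_kingPrV (M := cvM d L mv kk hL) (ι := ι) (L := L) (kk := kk) (r := r)).symm (hasMaj_tensorId ι (fun y y' => by positivity) hNL')
  -- (b) 𝔇(G′, G) with a non-negative constant
  have hDa0 : 0 ≤ max Da 0 * ((((L ^ kk : ℕ) : ℝ)) ^ (-(1 / 16 : ℝ)) + (14 * Real.exp 1 * (1 + Fintype.card (Fin (d + 1))) * basisConst e * ((1 + Fintype.card (Fin (d + 1))) * ((3 + 2 * ((d : ℝ) + 1)) * rA))) * (1 + Fintype.card (Fin (d + 1) ⊕ Fin (d + 1))) * ((((L ^ kk : ℕ) : ℝ))⁻¹)) := mul_nonneg (le_max_right _ _) hP0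
  have key0' := key0.mono fun y y' => mul_le_mul_of_nonneg_right (mul_le_mul_of_nonneg_right (le_max_left Da 0) hP0) (Real.exp_nonneg _)
  -- (c) 𝔇(N′_L, N_L) on the coloured carrier
  have hVι : HasMaj (CvNorm d L mv kk hL ι) (BlockNorm.ofBlocks (unitTorusGeo L kk (cvM d L mv kk hL)) (liftBlk (cvBlk d L mv kk hL ∘ kingPrV L kk r (cvM d L mv kk hL)) ι))
      (idef (pull (liftMap (kingPrV L kk r (cvM d L mv kk hL)) ι)) (pull (liftMap (kingPrV L kk r (cvM d L mv kk hL)) ι)) (cvNL' d L mv kk r hL a ι) (cvNL d L mv kk hL a ι))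
      (fun y y' => rr * ((L ^ kk : ℕ) : ℝ) ^ (-((1 / 8 : ℝ) / 2)) * Real.exp (-(δv * tdistT (cvM d L mv kk hL) y y'))) :=
    hasMaj_tgt_congr (liftBlk_blkCover_comp_kingPrV (M := cvM d L mv kk hL) (ι := ι) (L := L) (kk := kk) (r := r)).symm
      (hasMaj_idef_tensorId (ι := ι) (kingPrV L kk r (cvM d L mv kk hL)) (fun y y' => by positivity) (HV (mv + 1) kk r hk hL))
  have hrr0 : 0 ≤ rr * ((L ^ kk : ℕ) : ℝ) ^ (-((1 / 8 : ℝ) / 2)) := mul_nonneg hrr.le (Real.rpow_nonneg hkpos.le _)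
  -- the two compositions at half the master rate
  have htri := triangle254_unitTorusGeo L kk (cvM d L mv kk hL)
  have hdist := unitTorusGeo_dist_nonneg L kk (cvM d L mv kk hL)
  have hrow := rowSum_unitTorusGeo L kk (cvM d L mv kk hL) (half_pos hm0)
  have hA := hasMaj_comp_exp (ρ := m / 2) (σ := m / 2) htri hdist hrow hcN0 hDa0 (by positivity) (by linarith) (by linarith) hN'ι key0'
  have hB := hasMaj_comp_exp (ρ := m / 2) (σ := m / 2) htri hdist hrow hrr0 hBb.le (by positivity) (by linarith) (by linarith) hVι hG
  refine ((hA.add hB).neg).mono fun y y' => ?_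
  have hκ : (BlockNorm.ofBlocks (unitTorusGeo L kk (cvM d L mv kk hL)) (liftBlk (cvBlk d L mv kk hL ∘ kingPrV L kk r (cvM d L mv kk hL)) ι)).κ = 1 := rfl
  have hκ' : (CvNorm d L mv kk hL ι).κ = 1 := rfl
  rw [hκ, hκ']
  have hexp : (((L ^ kk : ℕ) : ℝ)) ^ (-((1 / 8 : ℝ) / 2)) = (((L ^ kk : ℕ) : ℝ)) ^ (-(1 / 16 : ℝ)) := by norm_num
  rw [hexp]
  have hE0 : 0 ≤ Real.exp (-(m / 2 * (unitTorusGeo L kk (cvM d L mv kk hL)).dist y y')) := Real.exp_nonneg _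
  have hSJ0 : 0 ≤ (14 * Real.exp 1 * (1 + Fintype.card (Fin (d + 1))) * basisConst e * ((1 + Fintype.card (Fin (d + 1))) * ((3 + 2 * ((d : ℝ) + 1)) * rA))) * (1 + Fintype.card (Fin (d + 1) ⊕ Fin (d + 1))) * ((((L ^ kk : ℕ) : ℝ))⁻¹) := by positivity
  have hxle : (((L ^ kk : ℕ) : ℝ)) ^ (-(1 / 16 : ℝ)) ≤ (((L ^ kk : ℕ) : ℝ)) ^ (-(1 / 16 : ℝ)) + (14 * Real.exp 1 * (1 + Fintype.card (Fin (d + 1))) * basisConst e * ((1 + Fintype.card (Fin (d + 1))) * ((3 + 2 * ((d : ℝ) + 1)) * rA))) * (1 + Fintype.card (Fin (d + 1) ⊕ Fin (d + 1))) * ((((L ^ kk : ℕ) : ℝ))⁻¹) := le_add_of_nonneg_right hSJ0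
  nlinarith [mul_nonneg (mul_nonneg (mul_nonneg hrr.le hBb.le) hcr0) (mul_nonneg (sub_nonneg.mpr hxle) hE0), mul_nonneg hcN0 (le_max_right Da 0), hE0, hP0, hcr0]

end Summit.QuantumFields.YangMills.BalabanUVNodes.N15.Gluing

end
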